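import Summits.NavierStokesRegularity.FunctionalMining.HsProductionBoundAllOrders
import Literature.Analysis.FluidPDE.TorusNSFoiasGuillopeTemam
import HarnessLib

/-!
# FunctionalMining — the Foias–Guillopé–Temam weighted dissipation bound of the family `EF.s`
# at EVERY real order `s > 1/2`: `ν ∫₀ᵀ E_{s+1}/(1+E_s)^{2s/(2s−1)} dt ≤ (2s−1) + κ_s ν^{−γ_s} ‖u(0)‖₂²/(2ν)`

Search for candidate a priori estimates; no regularity claim. Cell `pub-nsfunc`, lit seat (gen 16),
filed topic-side because the proof runs on the cell's Ḣˢ production bounds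
(`HsProductionBoundAllOrders`, prove seat), which `Literature/` cannot import. First of three files
(`HsWeightedDissipation`, `HsTimeAverageStep`, `HsTimeAverages`) typing the published a-priori ledger
entry of Foias, Guillopé & Temam (Comm. PDE 6 (1981), Thm 3.1; restated as Thm 2, (3.4)–(3.5) of
W. Chen, Diff. Integral Eqs. 7 (1994) 101–107 [held, p. 103]): for Leray–Hopf weak solutions on the
periodic box and every integer `m ≥ 1`,

`∫₀ᵀ |A^{(m+1)/2}u|² / (1 + |A^{m/2}u|²)^{2m/(2m−1)} dt ≤ K₂(1+T)`,  `∫₀ᵀ |A^{m/2}u|^{2/(2m−1)} dt ≤ K₃(1+T)`,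

`K₂, K₃` depending on `ν`, the box, the force and `|u₀|` (CRITERIA §B rows B3/B4: the backbone of
Gibbon's chessboard, column `m = 1` at every `n`; the tree had the rungs `H¹ → H² → H³` only,
`TorusNSFoiasGuillopeTemam`, `TorusNSFoiasGuillopeTemamH3`). Here, for CLASSICAL zero-mean solutions of
the unforced system on `[0, T] × T³` and the homogeneous Sobolev energies
`E_s(v) = ‖v‖²_{Ḣˢ} = ∑_k (4π²|k|²)^s ‖v̂(k)‖²` (`torusHsEnergy`, `E_1 = ‖∇v‖₂² = 2ℰ`), THIS FILE proves
(3.4) at every REAL `s > 1/2`, uniformly in `T`: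

* `HsTimeAverages.rate_le` — the Ḣˢ balance with HALF the dissipation kept: for `s > 1/2` and
  `HsProductionBound s C`, `dE_s/dt ≤ −ν E_{s+1} + C^{4s/(2s−1)} ν^{−(2s+1)/(2s−1)} (2ℰ) E_s^{2s/(2s−1)}`
  (exact balance `dE_s/dt = N_s − 2νE_{s+1}` of `HsEnergyBalance` + Young, as in
  `HsSaturatingLawReduction` but without dropping `−νE_{s+1}`);
* `HsTimeAverages.weightedDissipation_le` — **(3.4) at every real `s > 1/2`, uniformly in `T`**:
  `ν ∫₀ᵀ E_{s+1}/(1 + E_s)^{2s/(2s−1)} dt ≤ (2s − 1) + C^{4s/(2s−1)} ν^{−(2s+1)/(2s−1)} ‖u(0)‖₂²/(2ν)`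
  (the FGT device: `g = (2s−1)(1+E_s)^{−1/(2s−1)}` has `g' = −E_s'(1+E_s)^{−2s/(2s−1)}`, `0 ≤ g ≤ 2s−1`,
  and `∫₀ᵀ 2ℰ = ∫₀ᵀ‖∇u‖₂² ≤ ‖u(0)‖₂²/(2ν)`), with the `∃ K` form `exists_weightedDissipation_le` from
  `exists_hsProductionBound`.

Faithfulness / scope: FGT prove Thm 3.1 for weak solutions (Galerkin) with a force, at integer
orders; here classical solutions, `f = 0`, every real order, on the unit torus, the constant existential
through the cell's production constant `C = C(s)` (lattice sums), in the sharper `T`-uniform form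
(`s = 1` is the tree's `Torus.classicalNS_integral_laplacianSq_div_sq_le` up to constants). A priori
bound in the energy class; it asserts neither regularity nor blow-up.

## Mathlib / tree search

Tree (used): `hasDerivWithinAt_torusHsEnergy_NS`, `torusHsEnergy_nonneg`, `torusHsEnergy_one`
(`HsEnergyBalance`); `HsProductionBound`, `exists_hsProductionBound`, `two_mul_torusEnstrophy_eq`
(`HsSaturatingLawReduction`, `HsProductionBoundRows`, `…AllOrders`); `VorticityMoment.young_rpow`;
`Torus.classicalNS_integral_gradNormSq_le` (`TorusNSFoiasGuillopeTemam`); Mathlib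
`intervalIntegral.integral_le_sub_of_hasDeriv_right_of_le`, `HasDerivWithinAt.rpow_const`. Searched
`weightedDissipation|1 + torusHsEnergy` under FunctionalMining, `2m - 1|all orders` under Literature:
only the rungs `m ≤ 3`.

## References

* [FoiasGuillopeTemam1981] C. Foias, C. Guillopé, R. Temam, *New a priori estimates for Navier–Stokes
  equations in dimension 3*, Comm. PDE 6 (1981) 329–359, Thm 3.1.
* [Chen1994GevreyAPriori] W. Chen, *New a priori estimates in Gevrey class of regularity for weak
  solutions of 3D Navier–Stokes equations*, Differential Integral Equations 7 (1994) 101–107, Thm 2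
  (3.4)–(3.5) [held: paper:doi-10-57262-die-1369926969, p. 103].
* [Gibbon2019Chessboard] J. D. Gibbon, J. Nonlinear Sci. 29 (2019) 215–228, Thm 1, Table 1 (column
  `m = 1`).
-/

noncomputable section

open MeasureTheory Set Filter Topology Function Real intervalIntegral
open scoped InnerProductSpace RealInnerProductSpace ENNReal

namespace Summit.NavierStokesRegularity.FunctionalMining

open Literature.Analysis Literature.Analysis.FunctionSpaces Literature.Analysis.FluidPDE
open Literature.Analysis.FunctionSpaces.Torus Literature.Analysis.FluidPDE.Torus

namespace HsTimeAverages

/-! ## 1. Continuity in time and the rate inequality with half the dissipation kept -/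

/-- Along a classical solution on `[0, T] × T³`, `t ↦ E_s(u(t))` is continuous on `[0, T]` for every
real `s ≥ 0` (it is differentiable within `[0, T]`: the exact Ḣˢ balance). [folklore] -/
theorem continuousOn_hsEnergy {s ν T : ℝ} (hs : 0 ≤ s) (hT : 0 < T)
    {u : ℝ → UnitAddTorus (Fin 3) → EuclideanSpace ℝ (Fin 3)} {p : ℝ → UnitAddTorus (Fin 3) → ℝ}
    (h : IsClassicalNSSolutionOn (Icc 0 T) ν 0 u p) :
    ContinuousOn (fun t => torusHsEnergy s (u t)) (Icc 0 T) := fun _ ht =>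
  (hasDerivWithinAt_torusHsEnergy_NS hs h hT ht).continuousWithinAt

/-- **The Ḣˢ rate with half the dissipation kept.** If `HsProductionBound s C` (`s > 1/2`, `C ≥ 0`),
then along a classical zero-mean solution of unforced Navier–Stokes on `[0, T] × T³` with `ν > 0`, at
every `t ∈ [0, T]`,
`dE_s/dt = N_s − 2νE_{s+1} ≤ −ν E_{s+1} + C^{4s/(2s−1)} ν^{−(2s+1)/(2s−1)} (2ℰ) E_s^{1+1/(2s−1)}`
(Young with weights `a = (2s+1)/(4s)`, `1 − a`, applied to `|N_s| ≤ C (2ℰ)^{(2s−1)/(4s)}E_s^{1/2}E_{s+1}^a`).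
[ours; the step "Young" of FoiasGuillopeTemam1981 Thm 3.1 at real order] -/
theorem rate_le {s C ν T : ℝ} (hs : 1 / 2 < s) (hC : 0 ≤ C) (hPB : HsProductionBound s C)
    (hν : 0 < ν) {u : ℝ → UnitAddTorus (Fin 3) → EuclideanSpace ℝ (Fin 3)}
    {p : ℝ → UnitAddTorus (Fin 3) → ℝ}
    (h : IsClassicalNSSolutionOn (Icc 0 T) ν 0 u p) (hmean : ∀ t ∈ Icc 0 T, HasZeroMean (u t))
    {t : ℝ} (ht : t ∈ Icc 0 T) :
    hsInertialRate s (u t) + ν * hsViscousRate s (u t) ≤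
      -ν * torusHsEnergy (s + 1) (u t) +
        C ^ (4 * s / (2 * s - 1)) * ν ^ (-((2 * s + 1) / (2 * s - 1))) *
          (2 * torusEnstrophy (u t)) * torusHsEnergy s (u t) ^ (1 + (2 * s - 1)⁻¹) := by
  have hs0 : 0 ≤ s := by linarith
  have h4s : 0 < 4 * s := by linarith
  have h2s1 : 0 < 2 * s - 1 := by linarith
  obtain ⟨e, he⟩ : ∃ e : ℝ, e = (2 * s + 1) / (4 * s) := ⟨_, rfl⟩
  have he0 : 0 < e := by rw [he]; positivity
  have he1 : e < 1 := by rw [he, div_lt_one h4s]; linarith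
  have h1e : 1 - e = (2 * s - 1) / (4 * s) := by
    rw [he]; field_simp; ring
  have hγ : e / (1 - e) = (2 * s + 1) / (2 * s - 1) := by
    rw [h1e, he, div_div_div_cancel_right₀ h4s.ne']
  have hκ : 1 / (1 - e) = 4 * s / (2 * s - 1) := by
    rw [h1e, one_div_div]
  have hhalf : (1 + (2 * s - 1)⁻¹) * (1 - e) = 1 / 2 := by
    rw [h1e]; field_simp; ring
  have hut : IsSmooth (u t) := h.smooth_velocity.isSmooth_slice ht
  have hdiv : IsDivFree (u t) := h.divFree t ht
  -- opaque names
  obtain ⟨N, hN⟩ : ∃ N : ℝ, N = hsInertialRate s (u t) := ⟨_, rfl⟩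
  obtain ⟨I, hI⟩ : ∃ I : ℝ, I = torusHsEnergy (s + 1) (u t) := ⟨_, rfl⟩
  obtain ⟨Z, hZ⟩ : ∃ Z : ℝ, Z = 2 * torusEnstrophy (u t) := ⟨_, rfl⟩
  obtain ⟨F, hF⟩ : ∃ F : ℝ, F = torusHsEnergy s (u t) := ⟨_, rfl⟩
  obtain ⟨M, hM⟩ : ∃ M : ℝ, M = Z * F ^ (1 + (2 * s - 1)⁻¹) := ⟨_, rfl⟩
  have hI0 : 0 ≤ I := by rw [hI]; exact torusHsEnergy_nonneg (by linarith) hut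
  have hZ0 : 0 ≤ Z := by rw [hZ]; exact mul_nonneg (by norm_num) (torusEnstrophy_nonneg _)
  have hF0 : 0 ≤ F := by rw [hF]; exact torusHsEnergy_nonneg hs0 hut
  have hM0 : 0 ≤ M := by rw [hM]; exact mul_nonneg hZ0 (Real.rpow_nonneg hF0 _)
  have hV : hsViscousRate s (u t) = -2 * I := by rw [hsViscousRate, hI]
  -- the static bound in Young's form `|N| ≤ C I^e M^{1-e}`
  have hstat : |N| ≤ C * I ^ e * M ^ (1 - e) := by
    have h1 := hPB (u t) hut hdiv (hmean t ht)
    rw [← hN, ← hZ, ← hF, ← hI, ← he] at h1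
    have hMe : M ^ (1 - e) = Z ^ ((2 * s - 1) / (4 * s)) * F ^ (1 / 2 : ℝ) := by
      rw [hM, Real.mul_rpow hZ0 (Real.rpow_nonneg hF0 _), ← Real.rpow_mul hF0, hhalf, h1e]
    rw [hMe]
    calc |N| ≤ C * Z ^ ((2 * s - 1) / (4 * s)) * F ^ (1 / 2 : ℝ) * I ^ e := h1
      _ = C * I ^ e * (Z ^ ((2 * s - 1) / (4 * s)) * F ^ (1 / 2 : ℝ)) := by ring
  have hY := VorticityMoment.young_rpow he0 he1 hC hI0 hM0 hν
  rw [hV, ← hN, ← hI, ← hZ, ← hF]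
  have hNle : N ≤ |N| := le_abs_self N
  have hbudget : C ^ (4 * s / (2 * s - 1)) * ν ^ (-((2 * s + 1) / (2 * s - 1))) * Z *
      F ^ (1 + (2 * s - 1)⁻¹) = C ^ (1 / (1 - e)) * ν ^ (-(e / (1 - e))) * M := by
    rw [hκ, hγ, hM]; ring
  rw [hbudget]
  linarith [hstat, hY]

/-! ## 2. The FGT device: the weighted dissipation bound (3.4), uniformly in `T` -/

/-- **Weighted Ḣ^{s+1} dissipation bound at real order `s > 1/2` (FGT (3.4)), `T`-uniform.** If
`HsProductionBound s C` (`C ≥ 0`), then along every classical zero-mean solution of unforced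
Navier–Stokes with `ν > 0` on `[0, T] × T³`, `T > 0`,
`ν ∫₀ᵀ E_{s+1}(u(t)) / (1 + E_s(u(t)))^{1+1/(2s−1)} dt ≤ (2s−1) + C^{4s/(2s−1)} ν^{−(2s+1)/(2s−1)} ‖u(0)‖₂²/(2ν)`.
Proof: `g(t) = (2s−1)(1+E_s)^{−1/(2s−1)}` has `g' = −E_s'(1+E_s)^{−1−1/(2s−1)} ≥ νE_{s+1}/(1+E_s)^{…} − κν^{−γ}(2ℰ)`
by `rate_le` (`E_s^{β} ≤ (1+E_s)^{β}`), `0 ≤ g ≤ 2s−1`, and `∫₀ᵀ 2ℰ = ∫₀ᵀ‖∇u‖₂² ≤ ‖u(0)‖₂²/(2ν)`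
(`Torus.classicalNS_integral_gradNormSq_le`). [cite: FoiasGuillopeTemam1981, Thm 3.1]
[cite: Chen1994GevreyAPriori, Thm 2 (3.4)] (real order, classical solutions; proof route ours) -/
theorem weightedDissipation_le {s C ν T : ℝ} (hs : 1 / 2 < s) (hC : 0 ≤ C) (hPB : HsProductionBound s C)
    (hν : 0 < ν) (hT : 0 < T) {u : ℝ → UnitAddTorus (Fin 3) → EuclideanSpace ℝ (Fin 3)}
    {p : ℝ → UnitAddTorus (Fin 3) → ℝ}
    (h : IsClassicalNSSolutionOn (Icc 0 T) ν 0 u p) (hmean : ∀ t ∈ Icc 0 T, HasZeroMean (u t)) :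
    ν * ∫ t in (0 : ℝ)..T, torusHsEnergy (s + 1) (u t) /
        (1 + torusHsEnergy s (u t)) ^ (1 + (2 * s - 1)⁻¹) ≤
      (2 * s - 1) + C ^ (4 * s / (2 * s - 1)) * ν ^ (-((2 * s + 1) / (2 * s - 1))) *
        ((∫ x, ‖u 0 x‖ ^ 2) / (2 * ν)) := by
  have hs0 : 0 ≤ s := by linarith
  have h2s1 : 0 < 2 * s - 1 := by linarith
  set σ : ℝ := 2 * s - 1 with hσ
  set β : ℝ := 1 + (2 * s - 1)⁻¹ with hβ
  set κ : ℝ := C ^ (4 * s / (2 * s - 1)) * ν ^ (-((2 * s + 1) / (2 * s - 1))) with hκ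
  have hκ0 : 0 ≤ κ := by rw [hκ]; exact mul_nonneg (Real.rpow_nonneg hC _) (Real.rpow_nonneg hν.le _)
  have hβ0 : 0 < β := by rw [hβ]; positivity
  set F : ℝ → ℝ := fun t => torusHsEnergy s (u t) with hFdef
  set I : ℝ → ℝ := fun t => torusHsEnergy (s + 1) (u t) with hIdef
  set Z : ℝ → ℝ := fun t => 2 * torusEnstrophy (u t) with hZdef
  have hF0 : ∀ t ∈ Icc 0 T, 0 ≤ F t := fun t ht =>
    torusHsEnergy_nonneg hs0 (h.smooth_velocity.isSmooth_slice ht)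
  have hI0 : ∀ t ∈ Icc 0 T, 0 ≤ I t := fun t ht =>
    torusHsEnergy_nonneg (by linarith) (h.smooth_velocity.isSmooth_slice ht)
  have hZ0 : ∀ t, 0 ≤ Z t := fun t => mul_nonneg (by norm_num) (torusEnstrophy_nonneg _)
  have h1F : ∀ t ∈ Icc 0 T, 0 < 1 + F t := fun t ht => by have := hF0 t ht; positivity
  -- the balance and the rate inequality
  set D : ℝ → ℝ := fun t => hsInertialRate s (u t) + ν * hsViscousRate s (u t) with hD
  have hFd : ∀ t ∈ Icc 0 T, HasDerivWithinAt F (D t) (Icc 0 T) t := fun t ht =>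
    hasDerivWithinAt_torusHsEnergy_NS hs0 h hT ht
  have hrate : ∀ t ∈ Icc 0 T, D t ≤ -ν * I t + κ * Z t * F t ^ β := fun t ht => by
    have := rate_le hs hC hPB hν h hmean ht
    simpa [hD, hκ, hIdef, hZdef, hFdef, hβ, mul_assoc] using this
  -- the monotone quantity `g = σ (1 + F)^{-1/σ}`
  set g : ℝ → ℝ := fun t => σ * (1 + F t) ^ (-(σ⁻¹)) with hg
  have h1Fd : ∀ t ∈ Icc 0 T, HasDerivWithinAt (fun τ => 1 + F τ) (D t) (Icc 0 T) t := fun t ht => by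
    simpa using (hFd t ht).const_add 1
  have hgd : ∀ t ∈ Icc 0 T, HasDerivWithinAt g
      (σ * (D t * (-(σ⁻¹)) * (1 + F t) ^ (-(σ⁻¹) - 1))) (Icc 0 T) t := fun t ht =>
    ((h1Fd t ht).rpow_const (p := -(σ⁻¹)) (Or.inl (h1F t ht).ne')).const_mul σ
  -- lower bound for `g'`
  set φ : ℝ → ℝ := fun t => ν * (I t / (1 + F t) ^ β) - κ * Z t with hφ
  have hφ_le : ∀ t ∈ Icc 0 T, φ t ≤ σ * (D t * (-(σ⁻¹)) * (1 + F t) ^ (-(σ⁻¹) - 1)) := by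
    intro t ht
    have hW : (1 + F t) ^ (-(σ⁻¹) - 1) = ((1 + F t) ^ β)⁻¹ := by
      rw [show (-(σ⁻¹) - 1) = -β by rw [hβ, hσ]; ring, Real.rpow_neg (h1F t ht).le]
    rw [hW]
    have hQ : 0 < (1 + F t) ^ β := Real.rpow_pos_of_pos (h1F t ht) _
    -- `F^β ≤ (1+F)^β`
    have hFβ : F t ^ β ≤ (1 + F t) ^ β :=
      Real.rpow_le_rpow (hF0 t ht) (by linarith) hβ0.le
    have hr := hrate t ht
    have key : ν * I t - κ * Z t * (1 + F t) ^ β ≤ -D t := by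
      nlinarith [hFβ, mul_nonneg hκ0 (hZ0 t)]
    have key2 : (ν * I t - κ * Z t * (1 + F t) ^ β) * ((1 + F t) ^ β)⁻¹ ≤ -D t * ((1 + F t) ^ β)⁻¹ :=
      mul_le_mul_of_nonneg_right key (inv_nonneg.2 hQ.le)
    have e1 : (ν * I t - κ * Z t * (1 + F t) ^ β) * ((1 + F t) ^ β)⁻¹ =
        ν * (I t / (1 + F t) ^ β) - κ * Z t := by
      field_simp
    have e2 : -D t * ((1 + F t) ^ β)⁻¹ = σ * (D t * (-(σ⁻¹)) * ((1 + F t) ^ β)⁻¹) := by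
      field_simp
    have : φ t = (ν * I t - κ * Z t * (1 + F t) ^ β) * ((1 + F t) ^ β)⁻¹ := by rw [e1]
    rw [this, ← e2]
    exact key2
  -- continuity and integrability
  have hFc : ContinuousOn F (Icc 0 T) := continuousOn_hsEnergy hs0 hT h
  have hIc : ContinuousOn I (Icc 0 T) := continuousOn_hsEnergy (by linarith) hT h
  have hZc : ContinuousOn Z (Icc 0 T) := by
    have h1 : ContinuousOn (fun t => torusHsEnergy 1 (u t)) (Icc 0 T) :=
      continuousOn_hsEnergy zero_le_one hT h
    refine h1.congr fun t ht => ?_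
    show 2 * torusEnstrophy (u t) = torusHsEnergy 1 (u t)
    exact two_mul_torusEnstrophy_eq (h.smooth_velocity.isSmooth_slice ht)
  have h1Fc : ContinuousOn (fun t => 1 + F t) (Icc 0 T) := continuousOn_const.add hFc
  have hWc : ContinuousOn (fun t => I t / (1 + F t) ^ β) (Icc 0 T) :=
    hIc.div (h1Fc.rpow_const fun t ht => Or.inl (h1F t ht).ne')
      fun t ht => (Real.rpow_pos_of_pos (h1F t ht) _).ne'
  have hφc : ContinuousOn φ (Icc 0 T) := (continuousOn_const.mul hWc).sub (continuousOn_const.mul hZc)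
  have hgc : ContinuousOn g (Icc 0 T) := fun t ht => (hgd t ht).continuousWithinAt
  have hgd' : ∀ t ∈ Ioo 0 T, HasDerivWithinAt g
      (σ * (D t * (-(σ⁻¹)) * (1 + F t) ^ (-(σ⁻¹) - 1))) (Ioi t) t := fun t ht =>
    ((hgd t (Ioo_subset_Icc_self ht)).hasDerivAt (Icc_mem_nhds ht.1 ht.2)).hasDerivWithinAt
  have hmain := intervalIntegral.integral_le_sub_of_hasDeriv_right_of_le hT.le hgc hgd'
    hφc.integrableOn_Icc (fun t ht => hφ_le t (Ioo_subset_Icc_self ht))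
  -- `g T - g 0 ≤ σ`
  have hT' : T ∈ Icc 0 T := right_mem_Icc.2 hT.le
  have h0' : (0 : ℝ) ∈ Icc 0 T := left_mem_Icc.2 hT.le
  have hgT : g T ≤ σ := by
    have h1 : (1 + F T) ^ (-(σ⁻¹)) ≤ 1 :=
      Real.rpow_le_one_of_one_le_of_nonpos (by linarith [hF0 T hT']) (by
        rw [neg_nonpos]; exact inv_nonneg.2 h2s1.le)
    have : g T = σ * (1 + F T) ^ (-(σ⁻¹)) := rfl
    nlinarith [h2s1]
  have hg0 : 0 ≤ g 0 := by
    have : g 0 = σ * (1 + F 0) ^ (-(σ⁻¹)) := rfl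
    rw [this]
    exact mul_nonneg h2s1.le (Real.rpow_nonneg (h1F 0 h0').le _)
  -- split `∫ φ`
  have hWi : IntervalIntegrable (fun t => I t / (1 + F t) ^ β) volume 0 T :=
    (hWc.mono (by rw [uIcc_of_le hT.le])).intervalIntegrable
  have hZi : IntervalIntegrable Z volume 0 T := (hZc.mono (by rw [uIcc_of_le hT.le])).intervalIntegrable
  have hsplit : ∫ t in (0 : ℝ)..T, φ t =
      ν * (∫ t in (0 : ℝ)..T, I t / (1 + F t) ^ β) - κ * ∫ t in (0 : ℝ)..T, Z t := by
    rw [hφ]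
    rw [intervalIntegral.integral_sub (hWi.const_mul ν) (hZi.const_mul κ),
      intervalIntegral.integral_const_mul, intervalIntegral.integral_const_mul]
  -- the energy-class input `∫₀ᵀ 2ℰ = ∫₀ᵀ ‖∇u‖₂² ≤ ‖u(0)‖₂²/(2ν)`
  have hE : ∫ t in (0 : ℝ)..T, Z t ≤ (∫ x, ‖u 0 x‖ ^ 2) / (2 * ν) := by
    have h1 := Literature.Analysis.FluidPDE.Torus.classicalNS_integral_gradNormSq_le hν hT h
    have h2 : ∫ t in (0 : ℝ)..T, Z t = ∫ t in (0 : ℝ)..T, Torus.gradNormSq (u t) :=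
      intervalIntegral.integral_congr fun t _ => by
        show 2 * torusEnstrophy (u t) = Torus.gradNormSq (u t)
        rw [gradNormSq_eq_two_mul_torusEnstrophy]
    rw [h2]; exact h1
  rw [hsplit] at hmain
  nlinarith [hmain, hgT, hg0, mul_le_mul_of_nonneg_left hE hκ0]

/-- **(3.4) at every real order `s > 1/2`, `∃ K` form** (the production constant of
`exists_hsProductionBound` made existential): for every `s > 1/2` there is `K ≥ 0`, depending on `s`
only, with `ν∫₀ᵀ E_{s+1}/(1+E_s)^{1+1/(2s−1)} ≤ (2s−1) + K ν^{−(2s+1)/(2s−1)} ‖u(0)‖₂²/(2ν)` along every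
classical zero-mean solution of unforced Navier–Stokes on `[0, T] × T³`, `ν > 0`, `T > 0`.
[cite: FoiasGuillopeTemam1981, Thm 3.1] [cite: Chen1994GevreyAPriori, Thm 2 (3.4)]
(real order, classical solutions; proof route ours) -/
theorem exists_weightedDissipation_le {s : ℝ} (hs : 1 / 2 < s) :
    ∃ K : ℝ, 0 ≤ K ∧ ∀ {ν T : ℝ}, 0 < ν → 0 < T →
      ∀ {u : ℝ → UnitAddTorus (Fin 3) → EuclideanSpace ℝ (Fin 3)} {p : ℝ → UnitAddTorus (Fin 3) → ℝ},
      IsClassicalNSSolutionOn (Icc 0 T) ν 0 u p → (∀ t ∈ Icc 0 T, HasZeroMean (u t)) →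
        ν * ∫ t in (0 : ℝ)..T, torusHsEnergy (s + 1) (u t) /
            (1 + torusHsEnergy s (u t)) ^ (1 + (2 * s - 1)⁻¹) ≤
          (2 * s - 1) + K * ν ^ (-((2 * s + 1) / (2 * s - 1))) * ((∫ x, ‖u 0 x‖ ^ 2) / (2 * ν)) := by
  obtain ⟨C, hC, hPB⟩ := exists_hsProductionBound hs
  exact ⟨C ^ (4 * s / (2 * s - 1)), Real.rpow_nonneg hC _, fun hν hT _ _ h hmean =>
    weightedDissipation_le hs hC hPB hν hT h hmean⟩

end HsTimeAverages

end Summit.NavierStokesRegularity.FunctionalMining
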